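import Summits.ResolutionOfSingularities.ResolutionOfSingularities.Theorems.FrobeniusLadderFRationalResolutionFixedChart
import Summits.ResolutionOfSingularities.ResolutionOfSingularities.Theorems.FrobeniusLadderFRationalResolutionFixedPointLogRegular
import HarnessLib

/-!
# Crux `FrobeniusLadder.FRationalResolution` (stmt-ResolutionOfSingularities-15317), line `redirect`,
# stub `stub_diagonalizableQuotientResolution` — MILESTONE R3-tame + L3: under the stub's `hq` with
# TAME groups, every point of `X` is the image of a `D(A)`-FIXED point of an honest étale quotient
# chart `Spec S₀ → X` at which `Spec S₀` is KATO-LOG-REGULAR for a sharp full-rank monomial chart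

Assembly of `…FixedChart.exists_fixed_chart` (tame charts can be renormalised so that the point is
fixed: localisation `S₀ → (S₀)_g`, then the finite étale Kummer cover `(S₀)_g → (S_g)^{(B_𝔔)}`,
grading coarsened to `A/B_𝔔`) with the fixed-point milestone
`…FixedPointLogRegular.exists_isLogRegularAt_of_fixed` (at a fixed prime the quotient chart
satisfies Kato's (2.1) for the monomial chart of a homogeneous regular system of parameters,
`P = ℤⁿ_{≥0} ⊓ ker(m ↦ Σ mᵢ aᵢ)`, `n = dim`):

* `exists_fixed_logRegular_chart_of_hq_tame` — for every `x ∈ X`: a chart `φ : Spec S₀ → X` of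
  the stub's shape (regular `S` of finite type graded by a finite abelian group, `φ` ÉTALE and
  compatible with the structure maps), a point `v ↦ x`, a prime `𝔔` of `S` over `v` which is
  FIXED (`S_a ⊆ 𝔔`, `a ≠ 0`), and homogeneous `y₁,…,y_n ∈ 𝔔`, `n = dim S_𝔔`, whose monomial
  chart `ψ : P → S₀` makes `Spec S₀` log regular at `v` (`LogChart.IsLogRegularAt`).

Compared with `…StubPointsLogRegular` (any field, but log-regularity only for the INTERMEDIATE
ring `S^{(B)}`, which is not a chart of `X`), the tame hypothesis `|A| ∈ k^×` buys an honest étale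
chart of `X`. What remains for the stub (tame case): resolve the local models `Spec k[P]`
compatibly along the étale charts (functorial toroidal resolution; or, for isolated singular
points, an `𝔪`-primary monomial centre — `…PrimaryCentreEtale`). Honest label: milestone, no stub
closed. No definitions, no named facts, no sorry.
[cite: Kato1994, Def. (2.1)] [folklore; cite: SGA1, Exp. I Prop. 7.6; SGA3, Exp. VIII §4–5]
-/

noncomputable section

-- single-problem summit: the doubled namespace component is forced
set_option linter.dupNamespace false

open CategoryTheory AlgebraicGeometry
open Literature.AlgebraicGeometry.Resolution

namespace Summit.ResolutionOfSingularities.ResolutionOfSingularities.Theorems.FRationalResolution.TameFixedLogRegular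

/-- **Tame `hq` ⇒ every point lies under a FIXED, Kato-log-regular point of an étale quotient
chart.** Under the hypothesis `hq` of `stub_diagonalizableQuotientResolution` strengthened by
tameness (`|A|` invertible in `k` for each chart), for every `x ∈ X` there are a chart
`φ : Spec S₀ → X` of the same shape (étale, `S` regular of finite type graded by a finite abelian
group `A`), `v ↦ x`, a prime `𝔔` of `S` over `v` containing every piece of non-zero degree, and a
homogeneous system `y` with its monomial chart `ψ : P → S₀`, `P = ℤⁿ_{≥0} ⊓ ker(m ↦ Σ mᵢ aᵢ)`,
`n = dim S_𝔔`, such that `LogChart.IsLogRegularAt P ψ (𝔔 ∩ S₀)`.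
[cite: Kato1994, Def. (2.1)] [folklore; cite: SGA1, Exp. I Prop. 7.6; SGA3, Exp. VIII §4–5] -/
theorem exists_fixed_logRegular_chart_of_hq_tame (k : Type) [Field k] (X : Scheme.{0})
    (g : X ⟶ Spec (.of k))
    (hq : ∀ x : X, ∃ (A : Type) (_ : AddCommGroup A) (_ : Finite A) (_ : DecidableEq A)
        (S : Type) (_ : CommRing S) (_ : Algebra k S) (𝒮 : A → Submodule k S)
        (_ : GradedAlgebra 𝒮), IsUnit ((Nat.card A : ℕ) : k) ∧ Algebra.FiniteType k S ∧
        IsRegularRing S ∧ ∃ φ : Spec (.of (𝒮 0)) ⟶ X, Etale φ ∧ x ∈ Set.range φ ∧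
          φ ≫ g = Spec.map (CommRingCat.ofHom (algebraMap k (𝒮 0))))
    (x : X) :
    ∃ (A : Type) (_ : AddCommGroup A) (_ : Finite A) (_ : DecidableEq A)
      (S : Type) (_ : CommRing S) (_ : Algebra k S) (𝒮 : A → Submodule k S) (_ : GradedAlgebra 𝒮)
      (_ : Algebra.FiniteType k S) (_ : IsRegularRing S)
      (φ : Spec (.of (𝒮 0)) ⟶ X) (_ : Etale φ)
      (_ : φ ≫ g = Spec.map (CommRingCat.ofHom (algebraMap k (𝒮 0))))
      (v : Spec (.of (𝒮 0))) (_ : φ v = x)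
      (𝔔 : Ideal S) (_ : 𝔔.IsPrime) (_ : 𝔔.comap (algebraMap (𝒮 0) S) = v.asIdeal),
      (∀ a : A, a ≠ 0 → ∀ s ∈ 𝒮 a, s ∈ 𝔔) ∧
      ∃ (n : ℕ) (y : Fin n → S) (a : Fin n → A),
        (∀ i, y i ∈ 𝔔 ∧ y i ∈ 𝒮 (a i)) ∧
        (n : WithBot ℕ∞) = ringKrullDim (Localization.AtPrime 𝔔) ∧
        ∃ ψ : Multiplicative ↥(AddSubmonoid.nonneg (Fin n → ℤ) ⊓
            AddMonoidHom.mker (Fintype.linearCombination ℤ a).toAddMonoidHom) →* 𝒮 0,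
          (∀ p, ((ψ (Multiplicative.ofAdd p) : 𝒮 0) : S) =
            ∏ i, y i ^ ((p : Fin n → ℤ) i).toNat) ∧
          LogChart.IsLogRegularAt _ ψ (𝔔.comap (algebraMap (𝒮 0) S)) := by
  classical
  obtain ⟨A, _, _, _, S, _, _, 𝒮, _, htame, hft, hreg, φ, hφ, ⟨v, hv⟩, hφg⟩ := hq x
  haveI := hft
  haveI := hreg
  haveI := hφ
  -- renormalise the chart so that the point is fixed
  obtain ⟨A', _, _, _, S', _, _, 𝒮', inst', hft', hreg', φ', hφ', hφ'g, v', 𝔔', h𝔔', h𝔔'v',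
    hfix, hv'⟩ := FixedChart.exists_fixed_chart k X g A S 𝒮 φ hφg htame v
  haveI := hft'
  haveI := hreg'
  haveI := h𝔔'
  have hA' : AddMonoid.IsTorsion A' := fun a => isOfFinAddOrder_of_finite a
  -- Kato-log-regularity at the fixed point
  obtain ⟨n, y, a, hya, hn, ψ, hψ, hlog⟩ :=
    FixedPointLogRegular.exists_isLogRegularAt_of_fixed 𝒮' hA' 𝔔' hfix
  exact ⟨A', _, ‹_›, ‹_›, S', _, _, 𝒮', inst', hft', hreg', φ', hφ', hφ'g, v', by rw [hv', hv],
    𝔔', h𝔔', h𝔔'v', hfix, n, y, a, hya, hn, ψ, hψ, hlog⟩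

end Summit.ResolutionOfSingularities.ResolutionOfSingularities.Theorems.FRationalResolution.TameFixedLogRegular

end
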